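import Summits.HodgeConjecture.CorCM.IrreducibleOddWeightsCanonicalPivotFamilies
import Summits.HodgeConjecture.CorCM.IrreducibleOddWeightsRightIdealsCMFields
import Literature.NumberTheory.ComplexMultiplication.CMTypeDictionaryGroupLevel
import Literature.NumberTheory.ComplexMultiplication.CMFieldNormalClosure
import Literature.AlgebraicGeometry.Pohlmann1968.CMTypeRankCharactersNumberField
import HarnessLib

/-!
# Canonical pivot, IX: the GALOIS MODEL — the exact defect of ANY two CM fields as a finite computation in `Aut(L)`
# for any normal CM number field `L` receiving both, through the orbits of the pointwise stabiliser of `Hom(K₁, L)`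

COR-CM (cell `pub-hodgecm2`, binder seat `b16` gen 65, count-neutral claim CANONICAL PIVOT, file C10 — CM fields;
theorems only, no definition, no named fact, no `sorry`).  NEW as stated, hence under `Summits/`.  HONEST FRAMING: the
exact codimension of `Hg(A₀ × A₁)` in `Hg(A₀) × Hg(A₁)` for abelian varieties with complex multiplication by ARBITRARY CM
fields, written on a FINITE group; `HC_CM` is neither used nor asserted.  This closes the honest-open item (ii) of the
claim's card («no transport of the orbit sums to a finite Galois model is filed»).

SETTING.  CM fields `K_i` with types `Φ_i`; a NORMAL CM number field `L` with embeddings `e_i : K_i → L` and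
`ι : L → ℂ` (e.g. the compositum of the Galois closures).  THE MODEL: the finite group `Aut(L) = L ≃+* L` acts on the
finite sets `Hom(K_i, L)` by composition (tree `EmbeddingAction`), with the types `Φ_i^L = {x | ι ∘ x ∈ Φ_i}` and the
conjugation `c_L` (Mathlib `IsCMField.complexConj L`).  Files C1/C2 gave the exact defect on `Aut(ℂ)`; here the SAME
abstract theorem (C1 `IrrOdd.typeRank_add_typeRank_eq_add_finrank_stabOrbitSum_inf`) is run on the model, and the ranks
are transported by the tree's change-of-group lemma (`typeRank_preimage_eq`: `x ↦ ι ∘ x` is an equivariant bijection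
`Hom(K_i, L) ≃ Hom(K_i, ℂ)` along the restriction `Aut(ℂ) ↠ Aut(L)`).

* §1 `comp_bijective`, `exists_ringEquiv_complex_apply_eq`, `typeRank_preimage_comp_eq_cmTypeRank`,
  **`typeRank_sigmaType_preimage_comp_eq_cmFamilyRank`** (the model computes `cmTypeRank` and `cmFamilyRank`),
  `isCMTypeWith_complexConj_preimage_comp` (`Φ_i^L` is a CM type for `c_L`, which is central in `Aut(L)`).
* §2 **`cmTypeRank_add_cmTypeRank_eq_cmFamilyRank_add_one_add_finrank_galStabOrbitSum_inf`** — FOR ANY TWO CM FIELDS: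
  **`dim Hg(A₀) + dim Hg(A₁) − dim Hg(A₀ × A₁) = dim(F₀ ∩ F₁)`** computed in `ℚ^{Aut(L)}`, with
  `F₀ = span{ g ↦ Σ_{x ∈ Aut(L/L₁)·x₀} u(Φ₀^L)(g·x) : x₀ ∈ Hom(K₀, L) }` — the orbits of the subgroup of `Aut(L)` fixing
  every embedding `K₁ → L` (`= Aut(L/L₁)`, `L₁ ⊆ L` the closure of `e₁(K₁)`), i.e. the classes of `Hom(K₀, L)` agreeing
  on `K₀ ∩ L₁`; `|Aut(L)|·([K₀:ℚ] + [K₁:ℚ])` integers decide everything; additive iff `F₀ ∩ F₁ = 0`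
  (`cmFamilyRank_add_card_eq_pair_iff_galStabOrbitSum_inf_eq_bot`); only `L` need be CM.  Gen 64 R2 gave the FREE model (`Aut(L)` acting on
  itself, where the pointwise stabilisers are trivial and no reduction occurs); this is the reduced one.  Families:
  **`sum_cmTypeRank_add_one_add_finrank_iSup_galStabOrbitSum_eq`**, `cmFamilyRank_add_card_eq_iff_iSupIndep_galStabOrbitSum`
  (C4's family pivot on the model: orbit sums over the automorphisms fixing every embedding of every other field).

## References

* [Shimura1998] G. Shimura, *Abelian Varieties with Complex Multiplication and Modular Functions*, §8.1, §32.7 («`r(ξ)` is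
  determined independently of the choice of `M`»), §18.2.
* [Dodson1987] B. Dodson, *On the Mumford–Tate group of an abelian variety with complex multiplication*, J. Algebra 111
  (1987), §1.1 (p. 50).
* [Gordon1999HodgeAVSurvey] B. B. Gordon, *A survey of the Hodge conjecture for abelian varieties*, §3 Theorem (proof),
  7.5–7.7.
* [Lang2002] S. Lang, *Algebra*, V §2 Thm. 2.8, VI §1 Thm. 1.1.
-/

set_option autoImplicit false

noncomputable section

open scoped BigOperators Classical

open NumberField Module

namespace Summit.HodgeConjecture.CorCM

open Literature.NumberTheory.ComplexMultiplication
open Literature.AlgebraicGeometry.Motives (CMType)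
open Literature.AlgebraicGeometry.Pohlmann1968

/-! ### §1 The model `Aut(L)` acting on `Hom(K_i, L)` -/

section Model

variable {I : Type} {K : I → Type} [∀ i, Field (K i)] [∀ i, NumberField (K i)]
  {L : Type} [Field L] [NumberField L] (ι : L →+* ℂ)

/-- **`x ↦ ι ∘ x` is a bijection `Hom(K_i, L) ≃ Hom(K_i, ℂ)`** for `L` normal receiving `K_i` (every complex embedding
of `K_i` lands in `ι(L)`). [cite: Shimura1998, §8.1] [cite: Lang2002, V §2 Thm. 2.8] -/
theorem comp_bijective [Normal ℚ L] (e : ∀ i, K i →+* L) (i : I) :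
    Function.Bijective fun x : K i →+* L => ι.comp x :=
  ⟨fun x x' h => RingHom.ext fun k => ι.injective (RingHom.congr_fun h k), fun t => by
    obtain ⟨g, rfl⟩ := exists_eq_comp_algEquiv_comp ι e i t
    exact ⟨(g : L →+* L).comp (e i), rfl⟩⟩

/-- Every automorphism of `L` is induced by an automorphism of `ℂ` along `ι`. [cite: Lang2002, V §2 Thm. 2.8] -/
theorem exists_ringEquiv_complex_apply_eq (g : L ≃+* L) : ∃ τ : ℂ ≃+* ℂ, ∀ y : L, τ (ι y) = ι (g y) :=
  exists_ringEquiv_comp_eq_algEquiv ι (AlgEquiv.ofRingEquiv (f := g) fun q => by rw [eq_ratCast, map_ratCast])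

/-- **The model computes `cmTypeRank`**: `Rank_{Aut(L)}(Ψ^L) = Rank_{Aut(ℂ)}(Ψ)` for `Ψ^L = {x | ι ∘ x ∈ Ψ}` — `Aut(ℂ)`
and `Aut(L)` induce the same permutations along `x ↦ ι ∘ x` (Shimura: «`r(ξ)` is determined independently of the choice
of `M`»). [cite: Shimura1998, §32.7] [cite: Dodson1987, §1.1 (p. 50)] -/
theorem typeRank_preimage_comp_eq [Normal ℚ L] (e : ∀ i, K i →+* L) (i : I) (Ψ : Set (K i →+* ℂ)) :
    typeRank (L ≃+* L) {x : K i →+* L | ι.comp x ∈ Ψ} = typeRank (ℂ ≃+* ℂ) Ψ := by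
  let f : (K i →+* L) ≃ (K i →+* ℂ) := Equiv.ofBijective _ (comp_bijective ι e i)
  have hf : ∀ x, f x = ι.comp x := fun _ => rfl
  rw [show {x : K i →+* L | ι.comp x ∈ Ψ} = f ⁻¹' Ψ from rfl]
  refine typeRank_preimage_eq Ψ f (fun g => ?_) (fun τ => ?_)
  · obtain ⟨τ, hτ⟩ := exists_ringEquiv_complex_apply_eq ι g
    exact ⟨τ, fun x => RingHom.ext fun k => by rw [hf, hf, ringEquiv_smul_apply, RingHom.comp_apply,
      RingHom.comp_apply, ringEquiv_smul_apply, hτ]⟩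
  · obtain ⟨γ, hγ⟩ := exists_algEquiv_comp_eq_smul ι τ
    exact ⟨(γ : L ≃+* L), fun x => RingHom.ext fun k => by
      rw [hf, hf, ringEquiv_smul_apply, RingHom.comp_apply, RingHom.comp_apply, ringEquiv_smul_apply, hγ]
      rfl⟩

/-- `cmTypeRank Φ = Rank_{Aut(L)}(Φ^L)`. [cite: Shimura1998, §32.7] -/
theorem typeRank_preimage_comp_eq_cmTypeRank [Normal ℚ L] (e : ∀ i, K i →+* L) (i : I) (Φ : CMType (K i)) :
    typeRank (L ≃+* L) {x : K i →+* L | ι.comp x ∈ Φ.1} = cmTypeRank Φ :=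
  typeRank_preimage_comp_eq ι e i Φ.1

/-- **The model computes `cmFamilyRank`**: `Rank_{Aut(L)}(Σ^L) = cmFamilyRank Φ` for the family type of the `Φ_i^L` on
`⊔_i Hom(K_i, L)` (ONE automorphism of `ℂ`, resp. of `L`, serves all slots). [cite: Shimura1998, §32.7]
[cite: Dodson1987, §1.1 (p. 50)] -/
theorem typeRank_sigmaType_preimage_comp_eq_cmFamilyRank [Normal ℚ L] (e : ∀ i, K i →+* L) (Φ : ∀ i, CMType (K i)) :
    typeRank (L ≃+* L) (sigmaType fun i => {x : K i →+* L | ι.comp x ∈ (Φ i).1}) = CMAlgebra.cmFamilyRank Φ := by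
  let f : (Σ i, (K i →+* L)) ≃ (Σ i, (K i →+* ℂ)) :=
    Equiv.sigmaCongrRight fun i => Equiv.ofBijective _ (comp_bijective ι e i)
  have hf : ∀ (i : I) (x : K i →+* L), f ⟨i, x⟩ = ⟨i, ι.comp x⟩ := fun _ _ => rfl
  rw [show (sigmaType fun i => {x : K i →+* L | ι.comp x ∈ (Φ i).1}) = f ⁻¹' CMAlgebra.familyType Φ from rfl]
  refine typeRank_preimage_eq (CMAlgebra.familyType Φ) f (fun g => ?_) (fun τ => ?_)
  · obtain ⟨τ, hτ⟩ := exists_ringEquiv_complex_apply_eq ι g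
    refine ⟨τ, fun x => ?_⟩
    obtain ⟨i, x⟩ := x
    rw [Sigma.smul_mk, hf, hf, CMAlgebra.smul_sigma_mk]
    congr 1
    exact RingHom.ext fun k => by
      rw [ringEquiv_smul_apply, RingHom.comp_apply, RingHom.comp_apply, ringEquiv_smul_apply, hτ]
  · obtain ⟨γ, hγ⟩ := exists_algEquiv_comp_eq_smul ι τ
    refine ⟨(γ : L ≃+* L), fun x => ?_⟩
    obtain ⟨i, x⟩ := x
    rw [Sigma.smul_mk, hf, hf, CMAlgebra.smul_sigma_mk]
    congr 1
    exact RingHom.ext fun k => by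
      rw [ringEquiv_smul_apply, RingHom.comp_apply, RingHom.comp_apply, ringEquiv_smul_apply, hγ]
      rfl

omit [∀ i, NumberField (K i)] [NumberField L] in
/-- The model's type vector, explicitly: `u(Φ^L)(g·x) = u(Φ)(ι ∘ g ∘ x)`. [cite: Dodson1987, §1.1 (p. 50)] -/
theorem antiVec_preimage_comp {i : I} (Φ : CMType (K i)) (g : L ≃+* L) (x : K i →+* L) :
    antiVec {x : K i →+* L | ι.comp x ∈ Φ.1} g x =
      antiVec Φ.1 (1 : ℂ ≃+* ℂ) (ι.comp ((g : L →+* L).comp x)) := by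
  by_cases hm : ι.comp ((g : L →+* L).comp x) ∈ Φ.1
  · rw [antiVec, antiVec, translateInd_of_mem (show g • x ∈ {x : K i →+* L | ι.comp x ∈ Φ.1} from hm),
      translateInd_of_mem (show (1 : ℂ ≃+* ℂ) • ι.comp ((g : L →+* L).comp x) ∈ Φ.1 by rwa [one_smul])]
  · rw [antiVec, antiVec, translateInd_of_not_mem (show g • x ∉ {x : K i →+* L | ι.comp x ∈ Φ.1} from hm),
      translateInd_of_not_mem (show (1 : ℂ ≃+* ℂ) • ι.comp ((g : L →+* L).comp x) ∉ Φ.1 by rwa [one_smul])]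


variable [IsCMField L]

omit [∀ i, NumberField (K i)] in
/-- **`Φ^L` is a CM type for the conjugation `c_L` of `L`** (`ι ∘ c_L = conj ∘ ι`, and `c_L` commutes with every
automorphism of the CM field `L`). [cite: Shimura1998, §18.2 Lemma (i)] -/
theorem isCMTypeWith_complexConj_preimage_comp (i : I) (Φ : CMType (K i)) :
    IsCMTypeWith ((IsCMField.complexConj L).toRingEquiv : L ≃+* L) {x : K i →+* L | ι.comp x ∈ Φ.1} where
  mem_iff x := by
    have hc : ι.comp ((((IsCMField.complexConj L).toRingEquiv : L ≃+* L)) • x) =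
        ComplexEmbedding.conjugate (ι.comp x) := RingHom.ext fun k => by
      rw [RingHom.comp_apply, ringEquiv_smul_apply, ComplexEmbedding.conjugate_coe_eq, RingHom.comp_apply]
      exact IsCMField.complexEmbedding_complexConj L ι (x k)
    change ι.comp x ∈ Φ.1 ↔ ¬ ι.comp (_ • x) ∈ Φ.1
    rw [hc]
    exact Φ.2 (ι.comp x)
  comm g x := RingHom.ext fun k => by
    simp only [ringEquiv_smul_apply]
    exact ringHom_map_complexConj (g : L →+* L) (x k)
  invol x := RingHom.ext fun k => by
    simp only [ringEquiv_smul_apply]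
    exact IsCMField.complexConj_apply_apply L (x k)

end Model

/-! ### §2 The exact defect on the Galois model -/

section Defect

variable {I : Type} [Fintype I] {K : I → Type} [∀ i, Field (K i)] [∀ i, NumberField (K i)]
  {L : Type} [Field L] [NumberField L] [IsCMField L] [Normal ℚ L]

/-- **THE EXACT DEFECT ON A FINITE GROUP, FOR ANY TWO CM FIELDS.**  `L` a normal CM number field receiving `K_{i₀}`,
`K_{i₁}` (`e`), `ι : L → ℂ`.  Then **`cmTypeRank Φ₀ + cmTypeRank Φ₁ = cmFamilyRank Φ + 1 + dim(F₀ ∩ F₁)`**, i.e.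
**`dim Hg(A₀) + dim Hg(A₁) − dim Hg(A₀ × A₁) = dim(F₀ ∩ F₁)`** in `ℚ^{Aut(L)}`, where `F₀` is spanned by the functions
`g ↦ Σ_{x ∈ Aut(L/L₁)·x₀} u(Φ₀^L)(g·x)` (`x₀ ∈ Hom(K_{i₀}, L)`; `Aut(L/L₁)` = the automorphisms fixing every embedding
`K_{i₁} → L`) and `F₁` symmetrically — C1's canonical pivot on the model of §1.  NO hypothesis on the fields.
[cite: Shimura1998, §32.7 and §8.1] [cite: Gordon1999HodgeAVSurvey, §3 Theorem and 7.5–7.7] -/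
theorem cmTypeRank_add_cmTypeRank_eq_cmFamilyRank_add_one_add_finrank_galStabOrbitSum_inf (ι : L →+* ℂ)
    (e : ∀ i, K i →+* L) {i₀ i₁ : I} (h01 : i₀ ≠ i₁) (hI : ∀ l, l = i₀ ∨ l = i₁) (Φ : ∀ i, CMType (K i)) :
    cmTypeRank (Φ i₀) + cmTypeRank (Φ i₁) = CMAlgebra.cmFamilyRank Φ + 1 +
      Module.finrank ℚ (Submodule.span ℚ (Set.range fun x₀ : K i₀ →+* L => fun g : L ≃+* L =>
            ∑ x ∈ Finset.univ.filter
              (fun x : K i₀ →+* L => ∃ n : L ≃+* L, (∀ y : K i₁ →+* L, n • y = y) ∧ n • x₀ = x),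
                antiVec {x : K i₀ →+* L | ι.comp x ∈ (Φ i₀).1} g x) ⊓
          Submodule.span ℚ (Set.range fun x₁ : K i₁ →+* L => fun g : L ≃+* L =>
            ∑ x ∈ Finset.univ.filter
              (fun x : K i₁ →+* L => ∃ n : L ≃+* L, (∀ y : K i₀ →+* L, n • y = y) ∧ n • x₁ = x),
                antiVec {x : K i₁ →+* L | ι.comp x ∈ (Φ i₁).1} g x) : Submodule ℚ ((L ≃+* L) → ℚ)) := by
  haveI : ∀ i, Nonempty (K i →+* L) := fun i => ⟨e i⟩
  have h := IrrOdd.typeRank_add_typeRank_eq_add_finrank_stabOrbitSum_inf (G := L ≃+* L) (E := fun i => K i →+* L)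
    (Φ := fun i => {x : K i →+* L | ι.comp x ∈ (Φ i).1})
    (fun i => isCMTypeWith_complexConj_preimage_comp ι i (Φ i)) hI h01
  rw [typeRank_preimage_comp_eq_cmTypeRank ι e, typeRank_preimage_comp_eq_cmTypeRank ι e,
    typeRank_sigmaType_preimage_comp_eq_cmFamilyRank ι e] at h
  exact h

/-- **`Hg(A₀ × A₁) = Hg(A₀) × Hg(A₁)` iff `F₀ ∩ F₁ = 0` on the Galois model** — decidable on the finite group `Aut(L)`.
[cite: Shimura1998, §32.7] [cite: Gordon1999HodgeAVSurvey, §3 Theorem and 7.5–7.7] -/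
theorem cmFamilyRank_add_card_eq_pair_iff_galStabOrbitSum_inf_eq_bot (ι : L →+* ℂ) (e : ∀ i, K i →+* L) {i₀ i₁ : I}
    (h01 : i₀ ≠ i₁) (hI : ∀ l, l = i₀ ∨ l = i₁) (Φ : ∀ i, CMType (K i)) :
    CMAlgebra.cmFamilyRank Φ + Fintype.card I = (∑ i, cmTypeRank (Φ i)) + 1 ↔
      Submodule.span ℚ (Set.range fun x₀ : K i₀ →+* L => fun g : L ≃+* L =>
            ∑ x ∈ Finset.univ.filter
              (fun x : K i₀ →+* L => ∃ n : L ≃+* L, (∀ y : K i₁ →+* L, n • y = y) ∧ n • x₀ = x),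
                antiVec {x : K i₀ →+* L | ι.comp x ∈ (Φ i₀).1} g x) ⊓
          Submodule.span ℚ (Set.range fun x₁ : K i₁ →+* L => fun g : L ≃+* L =>
            ∑ x ∈ Finset.univ.filter
              (fun x : K i₁ →+* L => ∃ n : L ≃+* L, (∀ y : K i₀ →+* L, n • y = y) ∧ n • x₁ = x),
                antiVec {x : K i₁ →+* L | ι.comp x ∈ (Φ i₁).1} g x) = (⊥ : Submodule ℚ ((L ≃+* L) → ℚ)) := by
  haveI : ∀ i, Nonempty (K i →+* L) := fun i => ⟨e i⟩
  have h := IrrOdd.typeRank_sigmaType_add_card_eq_iff_stabOrbitSum_inf_eq_bot (G := L ≃+* L)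
    (E := fun i => K i →+* L) (Φ := fun i => {x : K i →+* L | ι.comp x ∈ (Φ i).1})
    (fun i => isCMTypeWith_complexConj_preimage_comp ι i (Φ i)) hI h01
  rw [typeRank_sigmaType_preimage_comp_eq_cmFamilyRank ι e,
    Finset.sum_congr rfl fun i _ => typeRank_preimage_comp_eq_cmTypeRank ι e i (Φ i)] at h
  exact h

/-- **FAMILIES ON THE GALOIS MODEL**: `Σ_i cmTypeRank Φ_i + 1 + dim ⨆_j F_j = cmFamilyRank Φ + |I| + Σ_j dim F_j`, i.e.
**`Σ_i dim Hg(A_i) − dim Hg(∏_i A_i) = Σ_j dim F_j − dim Σ_j F_j`** in `ℚ^{Aut(L)}`, `F_j` spanned by the slot-`j` orbit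
sums over the subgroup of `Aut(L)` fixing every embedding of every OTHER field (C4's canonical family pivot on the
model; any finite family of CM fields received by the normal CM field `L`).
[cite: Shimura1998, §32.7] [cite: Gordon1999HodgeAVSurvey, §3 Theorem and 7.5–7.7] -/
theorem sum_cmTypeRank_add_one_add_finrank_iSup_galStabOrbitSum_eq [Nonempty I] (ι : L →+* ℂ) (e : ∀ i, K i →+* L)
    (Φ : ∀ i, CMType (K i)) :
    (∑ i, cmTypeRank (Φ i)) + 1 + Module.finrank ℚ (⨆ j, Submodule.span ℚ (Set.range fun x₀ : K j →+* L =>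
        fun g : L ≃+* L => ∑ x ∈ Finset.univ.filter
          (fun x : K j →+* L => ∃ n : L ≃+* L, (∀ i, i ≠ j → ∀ y : K i →+* L, n • y = y) ∧ n • x₀ = x),
            antiVec {x : K j →+* L | ι.comp x ∈ (Φ j).1} g x) : Submodule ℚ ((L ≃+* L) → ℚ)) =
      CMAlgebra.cmFamilyRank Φ + Fintype.card I +
        ∑ j, Module.finrank ℚ (Submodule.span ℚ (Set.range fun x₀ : K j →+* L => fun g : L ≃+* L =>
          ∑ x ∈ Finset.univ.filter
            (fun x : K j →+* L => ∃ n : L ≃+* L, (∀ i, i ≠ j → ∀ y : K i →+* L, n • y = y) ∧ n • x₀ = x),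
              antiVec {x : K j →+* L | ι.comp x ∈ (Φ j).1} g x)) := by
  haveI : ∀ i, Nonempty (K i →+* L) := fun i => ⟨e i⟩
  have h := IrrOdd.sum_typeRank_add_one_add_finrank_iSup_stabOrbitSum_eq (G := L ≃+* L) (E := fun i => K i →+* L)
    (Φ := fun i => {x : K i →+* L | ι.comp x ∈ (Φ i).1})
    (fun i => isCMTypeWith_complexConj_preimage_comp ι i (Φ i))
  rw [typeRank_sigmaType_preimage_comp_eq_cmFamilyRank ι e,
    Finset.sum_congr rfl fun i _ => typeRank_preimage_comp_eq_cmTypeRank ι e i (Φ i)] at h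
  exact h

/-- **`Hg(∏_i A_i) = ∏_i Hg(A_i)` iff the `F_j` are INDEPENDENT on the Galois model** (finite criterion for any family of
CM fields). [cite: Shimura1998, §32.7] [cite: Gordon1999HodgeAVSurvey, §3 Theorem and 7.5–7.7] -/
theorem cmFamilyRank_add_card_eq_iff_iSupIndep_galStabOrbitSum [Nonempty I] (ι : L →+* ℂ) (e : ∀ i, K i →+* L)
    (Φ : ∀ i, CMType (K i)) :
    CMAlgebra.cmFamilyRank Φ + Fintype.card I = (∑ i, cmTypeRank (Φ i)) + 1 ↔
      iSupIndep fun j => Submodule.span ℚ (Set.range fun x₀ : K j →+* L => fun g : L ≃+* L =>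
        ∑ x ∈ Finset.univ.filter
          (fun x : K j →+* L => ∃ n : L ≃+* L, (∀ i, i ≠ j → ∀ y : K i →+* L, n • y = y) ∧ n • x₀ = x),
            antiVec {x : K j →+* L | ι.comp x ∈ (Φ j).1} g x) := by
  haveI : ∀ i, Nonempty (K i →+* L) := fun i => ⟨e i⟩
  have h := IrrOdd.typeRank_sigmaType_add_card_eq_iff_iSupIndep_stabOrbitSum (G := L ≃+* L) (E := fun i => K i →+* L)
    (Φ := fun i => {x : K i →+* L | ι.comp x ∈ (Φ i).1})
    (fun i => isCMTypeWith_complexConj_preimage_comp ι i (Φ i))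
  rw [typeRank_sigmaType_preimage_comp_eq_cmFamilyRank ι e,
    Finset.sum_congr rfl fun i _ => typeRank_preimage_comp_eq_cmTypeRank ι e i (Φ i)] at h
  exact h

end Defect

end Summit.HodgeConjecture.CorCM

end
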